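import Mathlib
import Literature.Computability.AlgebraicComplexity.NestFreeMatchingPoly
import Summits.ValiantsHypothesis.ValiantsHypothesis.Theorems.FifoMatchingNNDivisionHardSplitFace
import Summits.ValiantsHypothesis.ValiantsHypothesis.Theorems.FifoMatchingNNDivisionHardLinearTransportExplicit
import Summits.ValiantsHypothesis.ValiantsHypothesis.Theorems.FifoMatchingNNPowersNotCertificates
import Summits.ValiantsHypothesis.ValiantsHypothesis.Theorems.FifoMatchingNNMonomialCofactorHard
import Summits.ValiantsHypothesis.ValiantsHypothesis.Theorems.FifoMatchingNNDivisionHardLexTransport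
import HarnessLib

/-!
# Route FifoMatching — crux `NNDivisionHard` (stmt-ValiantsHypothesis-21181): SPLIT COFACTORS `h = ι_L(f) · S'` transport to
# `f` itself — block products with a large block are not certificates

If the cofactor FACTORS through the prefix split — `h = ι_L(f) · S'` with `f` homogeneous on the arcs of `L = [0, 2b)` and `S'`
avoiding the `L`-internal arcs (crossing arcs allowed) — then the `𝟙_L`-top component of `h` is `ι_L(f) · top(S')` and the
explicit linear transport (`LinearTransport.exists_linear_transport_eq`) returns the cofactor `f` (times a positive constant):

* `isWeightedHomogeneous_rename_of_forall_eq_one` — `ι_L(f)` is `𝟙_L`-homogeneous when `f` is homogeneous;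
* ★★ `complexity_nn_mul_le_of_splitCofactor` — **`L₊(NN_b · f) ≤ L₊(NN_{b+c} · ι_L(f)·S') + 2`**;
* ★★ `complexity_pow_le_of_blockPowerCofactor` — instance `f = NN_b^j`: **`L₊(NN_b^{j+1}) ≤ L₊(NN_{b+c} · ι_L(NN_b^j)·S') + 2`**,
  so by `NNPowers.exp_lower_bound_pow` (`2^{b^{1/6}} ≤ L₊(NN_b^M)`): ★★ `blockPowerCofactor_exp_bound` — **every cofactor
  `ι_L(NN_b^j) · S'` (`j ≥ 0`, `S' ≠ 0` avoiding the block-internal arcs; in particular every BLOCK PRODUCT `ι_L(NN_b) · ι_R(q)`,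
  `blockProduct_exp_bound`) has `2^{b^{1/6}} ≤ L₊(NN_{b+c} · h) + 2`** — the «mixed powers» rung of `…BlockTransport` freed
  from the pinned rainbow window `a ∈ [(n−1)/3, (n−1)/2]` and from the power shape of the outside factor.

HONEST FRAMING: a rung; block products with ALL blocks small remain in the residual (see `…LocalCofactorInstances` /
`…ShortLocalConditional` for the reduction that would decide them); stmt-21181 stays OPEN; nothing here bears on `NNNotVP` or
on VP ≠ VNP (NOT proved).
References: Bürgisser 2000 Rem. 2.7 [Burgisser2000]; Jerrum–Snir 1982 §4.3 [JerrumSnir1982]; Hrubeš–Yehudayoff 2021 §6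
Problem 2 [HrubesYehudayoff2021].
-/

noncomputable section

-- Sub = Summit single-conjunct layout: the duplicated namespace component is mandated by the tree.
set_option linter.dupNamespace false
set_option autoImplicit false

namespace Summit.ValiantsHypothesis.ValiantsHypothesis.Theorems.FifoMatching.NNDivisionHard.SplitCofactor

open Finset MvPolynomial Literature.Computability.AlgebraicComplexity
open Summit.ValiantsHypothesis.ValiantsHypothesis.Theorems.ZeroOneTransfer.Negative
  (topComponent topComponent_mul complexity_topComponent_le topComponent_ne_zero support_topComponent_subset
    topComponent_eq_self_of_isWeightedHomogeneous)
open Summit.ValiantsHypothesis.ValiantsHypothesis.Theorems.FifoMatching.NNDivisionHard.StackPowersQueue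
  (blockEmb blockEmb_injective)
open Summit.ValiantsHypothesis.ValiantsHypothesis.Theorems.FifoMatching.NNDivisionHard.LinearTransport
  (exists_linear_transport_eq aeval_rename_of_kept aeval_eq_C_of_support eval_one_ne_zero)
open Summit.ValiantsHypothesis.ValiantsHypothesis.Theorems.FifoMatching.NNDivisionHard.SplitFace
  (lWeight blockEmbR two_mul_le blockEmbR_injective topComponent_lWeight support_rename_blockEmbR_outside)
open scoped NNReal BigOperators

/-! ### §1 Homogeneity of the block factor in the direction `𝟙_L` -/

/-- If `w ∘ ι ≡ 1` and `f` is homogeneous of degree `N`, then `ι(f)` is `w`-homogeneous of weight `N`. [folklore] -/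
theorem isWeightedHomogeneous_rename_of_forall_eq_one {σ τ : Type*} {ι : τ → σ} (hι : Function.Injective ι)
    (w : σ → ℕ) (hw : ∀ t, w (ι t) = 1) {f : MvPolynomial τ ℝ≥0} {N : ℕ} (hf : f.IsHomogeneous N) :
    IsWeightedHomogeneous w (rename ι f) N := by
  classical
  intro d' hd'
  have hmem : d' ∈ (rename ι f).support := mem_support_iff.2 hd'
  rw [support_rename_of_injective hι, Finset.mem_image] at hmem
  obtain ⟨d, hd, rfl⟩ := hmem
  have h1 : Finsupp.weight w (Finsupp.mapDomain ι d) = Finsupp.weight (1 : τ → ℕ) d := by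
    rw [Finsupp.weight_apply, Finsupp.weight_apply,
      Finsupp.sum_mapDomain_index (h := fun i c => c • w i) (fun _ => zero_smul ℕ _) (fun _ _ _ => add_smul _ _ _)]
    exact Finset.sum_congr rfl fun t _ => by simp only [hw t, Pi.one_apply]
  rw [h1]
  exact hf (mem_support_iff.1 hd)

variable {b c : ℕ}

/-- `𝟙_L ∘ ι_L ≡ 1`. [folklore] -/
theorem lWeight_blockEmb (t : Fin (2 * b) × Fin (2 * b)) : lWeight b c (blockEmb (two_mul_le b c) t) = 1 := by
  unfold lWeight
  rw [if_pos ⟨t.1.isLt, t.2.isLt⟩]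

/-! ### §2 Split cofactors transport to their block factor -/

/-- ★★ **SPLIT COFACTORS.**  If `h = ι_L(f) · S'` with `f ≠ 0` homogeneous on the arcs of the prefix block and `S' ≠ 0` avoiding
the block-internal arcs, then `L₊(NN_b · f) ≤ L₊(NN_{b+c} · h) + 2`. [cite: Burgisser2000, Rem. 2.7] -/
theorem complexity_nn_mul_le_of_splitCofactor {f : MvPolynomial (Fin (2 * b) × Fin (2 * b)) ℝ≥0} {N : ℕ}
    (hf : f.IsHomogeneous N) (hf0 : f ≠ 0) {S' : MvPolynomial (Fin (2 * (b + c)) × Fin (2 * (b + c))) ℝ≥0}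
    (hS'0 : S' ≠ 0) (hS' : ∀ m ∈ S'.support, ∀ e ∈ m.support, e ∉ Set.range (blockEmb (two_mul_le b c))) :
    complexity (nestFreeMatchingPoly b ℝ≥0 * f) ≤
      complexity (nestFreeMatchingPoly (b + c) ℝ≥0 * (rename (blockEmb (two_mul_le b c)) f * S')) + 2 := by
  classical
  set ι := blockEmb (two_mul_le b c) with hιdef
  have hι : Function.Injective ι := blockEmb_injective _
  let a : Fin (2 * (b + c)) × Fin (2 * (b + c)) → MvPolynomial (Fin (2 * (b + c)) × Fin (2 * (b + c))) ℝ≥0 :=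
    fun e => if e ∈ Set.range ι then X e else 1
  have hK : ∀ e, e ∈ Set.range ι → a e = X e := fun e he => by simp only [a, if_pos he]
  have hK' : ∀ e, e ∉ Set.range ι → a e = 1 := fun e he => by simp only [a, if_neg he]
  have hKι : ∀ t, a (ι t) = X (ι t) := fun t => hK _ ⟨t, rfl⟩
  have hh : rename ι f * S' ≠ 0 := mul_ne_zero ((map_ne_zero_iff _ (rename_injective _ hι)).2 hf0) hS'0
  obtain ⟨g, -, hgb, -, hg⟩ := exists_linear_transport_eq hι (lWeight b c) topComponent_lWeight
    (fun h0 => MonomialCofactor.nn_ne_zero c (rename_injective _ blockEmbR_injective (by rw [h0, map_zero])))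
    (support_rename_blockEmbR_outside _) a hK hK' hh
  -- the top component of the split cofactor and its substitution
  have htopf : topComponent (lWeight b c) (rename ι f) = rename ι f :=
    topComponent_eq_self_of_isWeightedHomogeneous _
      (isWeightedHomogeneous_rename_of_forall_eq_one hι (lWeight b c) lWeight_blockEmb hf)
  set S'' := topComponent (lWeight b c) S' with hS''
  have hS''0 : S'' ≠ 0 := topComponent_ne_zero _ hS'0
  have hS''out : ∀ m ∈ S''.support, ∀ e ∈ m.support, e ∉ Set.range ι :=
    fun m hm => hS' m (support_topComponent_subset _ S' hm)
  set κ := eval (fun _ => (1 : ℝ≥0)) S'' with hκ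
  have hκ0 : κ ≠ 0 := eval_one_ne_zero hS''0
  have hC : aeval a S'' = C κ := aeval_eq_C_of_support (Set.range ι) a hK' hS''out
  have hgf : g = f * C κ := by
    apply rename_injective ι hι
    rw [hg, topComponent_mul, htopf, map_mul, aeval_rename_of_kept ι a hKι, hC, map_mul, rename_C]
  -- remove the constant
  have H3 : nestFreeMatchingPoly b ℝ≥0 * f = nestFreeMatchingPoly b ℝ≥0 * g * C κ⁻¹ := by
    rw [hgf, mul_assoc, mul_assoc, ← C_mul, mul_inv_cancel₀ hκ0, C_1, mul_one]
  calc complexity (nestFreeMatchingPoly b ℝ≥0 * f)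
      = complexity (nestFreeMatchingPoly b ℝ≥0 * g * C κ⁻¹) := by rw [← H3]
    _ ≤ complexity (nestFreeMatchingPoly b ℝ≥0 * g) +
        complexity (C κ⁻¹ : MvPolynomial (Fin (2 * b) × Fin (2 * b)) ℝ≥0) + 1 := complexity_mul_le_holds _ _
    _ = complexity (nestFreeMatchingPoly b ℝ≥0 * g) + 1 := by rw [complexity_C_holds, add_zero]
    _ ≤ complexity (nestFreeMatchingPoly (b + c) ℝ≥0 * (rename ι f * S')) + 1 + 1 := by gcongr
    _ = _ := rfl

/-- ★★ **BLOCK-POWER COFACTORS.**  For `h = ι_L(NN_b^j) · S'` (`S' ≠ 0` avoiding the block-internal arcs):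
`L₊(NN_b^{j+1}) ≤ L₊(NN_{b+c} · h) + 2`. [cite: JerrumSnir1982, §4.3] -/
theorem complexity_pow_le_of_blockPowerCofactor (j : ℕ) {S' : MvPolynomial (Fin (2 * (b + c)) × Fin (2 * (b + c))) ℝ≥0}
    (hS'0 : S' ≠ 0) (hS' : ∀ m ∈ S'.support, ∀ e ∈ m.support, e ∉ Set.range (blockEmb (two_mul_le b c))) :
    complexity (nestFreeMatchingPoly b ℝ≥0 ^ (j + 1)) ≤
      complexity (nestFreeMatchingPoly (b + c) ℝ≥0 *
        (rename (blockEmb (two_mul_le b c)) (nestFreeMatchingPoly b ℝ≥0 ^ j) * S')) + 2 := by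
  have H := complexity_nn_mul_le_of_splitCofactor ((nestFreeMatchingPoly_isHomogeneous b).pow j)
    (pow_ne_zero j (MonomialCofactor.nn_ne_zero b)) hS'0 hS'
  rwa [← pow_succ'] at H

/-- ★★ **BLOCK-POWER COFACTORS ARE EXPONENTIALLY EXPENSIVE in the block size**: eventually in `b`, for all `c, j` and every
`S' ≠ 0` avoiding the internal arcs of the prefix block, `2^{b^{1/6}} ≤ L₊(NN_{b+c} · ι_L(NN_b^j)·S') + 2` — in particular for
every block product `ι_L(NN_b) · ι_R(q)`, `q ≠ 0`. [cite: JerrumSnir1982, §4.3] [cite: HrubesYehudayoff2021, §6 Problem 2] -/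
theorem blockPowerCofactor_exp_bound : ∃ b₀ : ℕ, ∀ b : ℕ, b₀ ≤ b → ∀ c j : ℕ,
    ∀ S' : MvPolynomial (Fin (2 * (b + c)) × Fin (2 * (b + c))) ℝ≥0, S' ≠ 0 →
    (∀ m ∈ S'.support, ∀ e ∈ m.support, e ∉ Set.range (blockEmb (two_mul_le b c))) →
    (2 : ℝ) ^ ((b : ℝ) ^ ((1 : ℝ) / 6)) ≤
      (complexity (nestFreeMatchingPoly (b + c) ℝ≥0 *
        (rename (blockEmb (two_mul_le b c)) (nestFreeMatchingPoly b ℝ≥0 ^ j) * S')) : ℝ) + 2 := by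
  obtain ⟨b₀, hb₀⟩ := NNPowers.exp_lower_bound_pow
  refine ⟨b₀, fun b hb c j S' hS'0 hS' => ?_⟩
  have H := complexity_pow_le_of_blockPowerCofactor (c := c) j hS'0 hS'
  have H' : (complexity (nestFreeMatchingPoly b ℝ≥0 ^ (j + 1)) : ℝ) ≤
      (complexity (nestFreeMatchingPoly (b + c) ℝ≥0 *
        (rename (blockEmb (two_mul_le b c)) (nestFreeMatchingPoly b ℝ≥0 ^ j) * S')) : ℝ) + 2 := by
    exact_mod_cast H
  exact (hb₀ b hb (j + 1) (by omega)).trans H'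

/-- ★ **BLOCK PRODUCTS with a large first block**: for `q ≠ 0` on the arcs of `[0, 2c)`, the cofactor `ι_L(NN_b) · ι_R(q)` has
`2^{b^{1/6}} ≤ L₊(NN_{b+c} · ι_L(NN_b)·ι_R(q)) + 2`, eventually in `b`. [cite: JerrumSnir1982, §4.3] -/
theorem blockProduct_exp_bound : ∃ b₀ : ℕ, ∀ b : ℕ, b₀ ≤ b → ∀ c : ℕ,
    ∀ q : MvPolynomial (Fin (2 * c) × Fin (2 * c)) ℝ≥0, q ≠ 0 →
    (2 : ℝ) ^ ((b : ℝ) ^ ((1 : ℝ) / 6)) ≤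
      (complexity (nestFreeMatchingPoly (b + c) ℝ≥0 *
        (rename (blockEmb (two_mul_le b c)) (nestFreeMatchingPoly b ℝ≥0) * rename (blockEmbR b c) q)) : ℝ) + 2 := by
  obtain ⟨b₀, hb₀⟩ := blockPowerCofactor_exp_bound
  refine ⟨b₀, fun b hb c q hq => ?_⟩
  have H := hb₀ b hb c 1 (rename (blockEmbR b c) q)
    (fun h0 => hq (rename_injective _ blockEmbR_injective (by rw [h0, map_zero])))
    (support_rename_blockEmbR_outside q)
  rwa [pow_one] at H

/-! ### §3 The suffix side (no homogeneity needed: `𝟙_L` vanishes on the suffix block) -/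

/-- `𝟙_L ∘ ι_R ≡ 0`. [folklore] -/
theorem lWeight_blockEmbR (t : Fin (2 * c) × Fin (2 * c)) : lWeight b c (blockEmbR b c t) = 0 := by
  unfold lWeight
  rw [if_neg]
  rintro ⟨h1, -⟩
  exact absurd h1 (by simp [blockEmbR, SplitFace.val_shiftR])

/-- ★★ **SPLIT COFACTORS, SUFFIX SIDE.**  If `h = S' · ι_R(f)` with `f ≠ 0` ANY polynomial on the arcs of the suffix block and
`S' ≠ 0` avoiding the suffix-internal arcs, then `L₊(NN_c · f) ≤ L₊(NN_{b+c} · h) + 2` (the direction `𝟙_L` vanishes on the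
suffix block, so no homogeneity of `f` is needed: `LexTransport.topComponent_rename_eq_self`). [cite: Burgisser2000, Rem. 2.7] -/
theorem complexity_nn_mul_le_of_splitCofactor_suffix {f : MvPolynomial (Fin (2 * c) × Fin (2 * c)) ℝ≥0} (hf0 : f ≠ 0)
    {S' : MvPolynomial (Fin (2 * (b + c)) × Fin (2 * (b + c))) ℝ≥0} (hS'0 : S' ≠ 0)
    (hS' : ∀ m ∈ S'.support, ∀ e ∈ m.support, e ∉ Set.range (blockEmbR b c)) :
    complexity (nestFreeMatchingPoly c ℝ≥0 * f) ≤
      complexity (nestFreeMatchingPoly (b + c) ℝ≥0 * (S' * rename (blockEmbR b c) f)) + 2 := by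
  classical
  set ι := blockEmbR b c with hιdef
  have hι : Function.Injective ι := blockEmbR_injective
  let a : Fin (2 * (b + c)) × Fin (2 * (b + c)) → MvPolynomial (Fin (2 * (b + c)) × Fin (2 * (b + c))) ℝ≥0 :=
    fun e => if e ∈ Set.range ι then X e else 1
  have hK : ∀ e, e ∈ Set.range ι → a e = X e := fun e he => by simp only [a, if_pos he]
  have hK' : ∀ e, e ∉ Set.range ι → a e = 1 := fun e he => by simp only [a, if_neg he]
  have hKι : ∀ t, a (ι t) = X (ι t) := fun t => hK _ ⟨t, rfl⟩
  have hh : S' * rename ι f ≠ 0 := mul_ne_zero hS'0 ((map_ne_zero_iff _ (rename_injective _ hι)).2 hf0)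
  obtain ⟨g, -, hgb, -, hg⟩ := exists_linear_transport_eq hι (lWeight b c) (topComponent_lWeight.trans (mul_comm _ _))
    (fun h0 => MonomialCofactor.nn_ne_zero b
      (rename_injective _ (blockEmb_injective (two_mul_le b c)) (by rw [h0, map_zero])))
    (SplitFace.support_rename_blockEmb_outside _) a hK hK' hh
  have htopf : topComponent (lWeight b c) (rename ι f) = rename ι f :=
    LexTransport.topComponent_rename_eq_self hι (lWeight b c) lWeight_blockEmbR f
  set S'' := topComponent (lWeight b c) S' with hS''
  have hS''0 : S'' ≠ 0 := topComponent_ne_zero _ hS'0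
  have hS''out : ∀ m ∈ S''.support, ∀ e ∈ m.support, e ∉ Set.range ι :=
    fun m hm => hS' m (support_topComponent_subset _ S' hm)
  set κ := eval (fun _ => (1 : ℝ≥0)) S'' with hκ
  have hκ0 : κ ≠ 0 := eval_one_ne_zero hS''0
  have hC : aeval a S'' = C κ := aeval_eq_C_of_support (Set.range ι) a hK' hS''out
  have hgf : g = C κ * f := by
    apply rename_injective ι hι
    rw [hg, topComponent_mul, htopf, map_mul, aeval_rename_of_kept ι a hKι, hC, map_mul, rename_C]
  have H3 : nestFreeMatchingPoly c ℝ≥0 * f = C κ⁻¹ * (nestFreeMatchingPoly c ℝ≥0 * g) := by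
    rw [hgf, show C κ⁻¹ * (nestFreeMatchingPoly c ℝ≥0 * (C κ * f)) = C (κ⁻¹ * κ) * (nestFreeMatchingPoly c ℝ≥0 * f) by
      rw [C_mul]; ring, inv_mul_cancel₀ hκ0, C_1, one_mul]
  calc complexity (nestFreeMatchingPoly c ℝ≥0 * f)
      = complexity (C κ⁻¹ * (nestFreeMatchingPoly c ℝ≥0 * g)) := by rw [← H3]
    _ ≤ complexity (C κ⁻¹ : MvPolynomial (Fin (2 * c) × Fin (2 * c)) ℝ≥0) +
        complexity (nestFreeMatchingPoly c ℝ≥0 * g) + 1 := complexity_mul_le_holds _ _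
    _ = complexity (nestFreeMatchingPoly c ℝ≥0 * g) + 1 := by rw [complexity_C_holds, zero_add]
    _ ≤ complexity (nestFreeMatchingPoly (b + c) ℝ≥0 * (S' * rename ι f)) + 1 + 1 := by gcongr
    _ = _ := rfl

/-- ★★ **BLOCK-POWER COFACTORS, SUFFIX SIDE**: `h = S' · ι_R(NN_c^j)` ⇒ `2^{c^{1/6}} ≤ L₊(NN_{b+c} · h) + 2`, eventually in `c`.
[cite: JerrumSnir1982, §4.3] -/
theorem blockPowerCofactor_exp_bound_suffix : ∃ c₀ : ℕ, ∀ c : ℕ, c₀ ≤ c → ∀ b j : ℕ,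
    ∀ S' : MvPolynomial (Fin (2 * (b + c)) × Fin (2 * (b + c))) ℝ≥0, S' ≠ 0 →
    (∀ m ∈ S'.support, ∀ e ∈ m.support, e ∉ Set.range (blockEmbR b c)) →
    (2 : ℝ) ^ ((c : ℝ) ^ ((1 : ℝ) / 6)) ≤
      (complexity (nestFreeMatchingPoly (b + c) ℝ≥0 *
        (S' * rename (blockEmbR b c) (nestFreeMatchingPoly c ℝ≥0 ^ j))) : ℝ) + 2 := by
  obtain ⟨c₀, hc₀⟩ := NNPowers.exp_lower_bound_pow
  refine ⟨c₀, fun c hc b j S' hS'0 hS' => ?_⟩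
  have H := complexity_nn_mul_le_of_splitCofactor_suffix (b := b)
    (pow_ne_zero j (MonomialCofactor.nn_ne_zero c)) hS'0 hS'
  rw [← pow_succ'] at H
  have H' : (complexity (nestFreeMatchingPoly c ℝ≥0 ^ (j + 1)) : ℝ) ≤
      (complexity (nestFreeMatchingPoly (b + c) ℝ≥0 *
        (S' * rename (blockEmbR b c) (nestFreeMatchingPoly c ℝ≥0 ^ j))) : ℝ) + 2 := by
    exact_mod_cast H
  exact (hc₀ c hc (j + 1) (by omega)).trans H'

end Summit.ValiantsHypothesis.ValiantsHypothesis.Theorems.FifoMatching.NNDivisionHard.SplitCofactor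

end
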